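import Summits.BirchSwinnertonDyer.BirchSwinnertonDyer.Theorems.Rank2Observatory2DescParity
import Mathlib.Topology.Order.IntermediateValue
import Mathlib.Analysis.SpecialFunctions.Pow.Real
import Mathlib.Data.Rat.Lemmas
import HarnessLib

/-!
# BirchSwinnertonDyer — rank ≥ 2 observatory: the norm and real-sign functionals of the cubic-field 2-descent

HONEST FRAMING: per-curve certified theorems and census instruments; no claim on BSD in rank ≥ 2.

Generic file of the KERNEL-2DESC instrument (design `b2b-bsdr2-cert-3/KERNEL-2DESC.md` §2 (M5),
§4 A3/A5(iv)): the two families of `𝔽₂`-functionals cutting the explicit group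
`⟨units, prime divisors of F′(θ)⟩·K×²` down to the subspace `V` that can contain a descent value
`(x − θ)·K×²` of a rational point of `E : y² = F(x) = x³ + Ax² + Bx + C` (`F` irreducible,
`K = ℚ(θ)`):

* NORM: `N_{K/ℚ}(x − θ) = F(x) = y²`, so `(x − θ)·z ∈ K²` forces `N(z) ∈ ℚ²`
  (`isSquare_norm_of_isSquare_mul`; `y ≠ 0` by irreducibility, `y_ne_zero_of_irreducible`);
* REAL SIGN at a real place `ρ` whose root `e = ρ(θ)` carries the positive-definite cofactor
  (`0 < 3e² + 2Ae + 4B − A²`, i.e. `F(t) = (t − e)·q(t)` with `q > 0` on `ℝ` — automatic when `F`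
  has one real root): `x − e > 0` on real points (`sub_rho_theta_pos`), so `(x − θ)·z ∈ K²` forces
  `ρ(z) > 0` (`rho_pos_of_isSquare_mul`); real embeddings with `ρ(θ)` in a rational interval come
  from a sign change of `F` (`exists_real_embedding_of_sign_change`, IVT + the power basis);
* the computable STANDARD SIEVE `admStd` on pairs of sub-products (integer norms of the generators,
  one sign bit each) and its soundness `admStd_sound`, which is exactly the hypothesis `hadm` of
  `mordellWeilRank_le_of_coverSet` (`…2DescVCover`).

Sorry-free; axioms `propext`, `Classical.choice`, `Quot.sound`. Mathematics: Cassels, *Lectures on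
Elliptic Curves* (1991) §15 (norm condition and the localisation at the real place); Silverman AEC
X.1 (Prop. X.1.4).
-/

-- single-conjunct summit: `Summit.BirchSwinnertonDyer.BirchSwinnertonDyer.…` repeats the name by design
set_option linter.dupNamespace false

noncomputable section

open scoped Classical NumberField

open Literature.NumberTheory.NumberFields Polynomial Module

namespace Summit.BirchSwinnertonDyer.BirchSwinnertonDyer.Rank2Observatory.TwoDescCubic

/-! ## `y ≠ 0` on an irreducible cubic -/

/-- A rational point of `y² = F(x)` with `F` irreducible over `ℚ` has `y ≠ 0` (else `x` would be a
rational root). [folklore] -/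
theorem y_ne_zero_of_irreducible {A B C : ℤ} (hirr : Irreducible (MonicCubic.polyQ A B C))
    {x y : ℚ} (hE : y ^ 2 = x ^ 3 + A * x ^ 2 + B * x + C) : y ≠ 0 := by
  rintro rfl
  have hroot : IsRoot (MonicCubic.polyQ A B C) x := by
    rw [IsRoot, MonicCubic.polyQ_eq]
    simp only [eval_add, eval_mul, eval_pow, eval_X, eval_C]
    linear_combination -hE
  have h1 := degree_eq_one_of_irreducible_of_root hirr hroot
  have h3 : (MonicCubic.polyQ A B C).degree = 3 := by
    rw [MonicCubic.polyQ_eq]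
    compute_degree!
  rw [h3] at h1
  exact absurd h1 (by decide)

/-! ## The norm functional -/

section Norm

variable {K : Type*} [Field K] [NumberField K] {A B C : ℤ} {θ : K}

/-- **Norm condition**: if `(x − θ)·z` is a square in `K` for a rational point `(x, y)` of
`y² = F(x)` (`F` irreducible, `K = ℚ(θ)` cubic), then `N_{K/ℚ}(z)` is a rational square
(`N(x − θ) = F(x) = y²`, `y ≠ 0`). [cite: Cassels1991LecturesEllipticCurves, §15] -/
theorem isSquare_norm_of_isSquare_mul (hirr : Irreducible (MonicCubic.polyQ A B C))
    (hθ : aeval θ (MonicCubic.poly A B C) = 0) (h3 : finrank ℚ K = 3) {x y : ℚ}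
    (hE : y ^ 2 = x ^ 3 + A * x ^ 2 + B * x + C) {z : K}
    (hsq : IsSquare ((algebraMap ℚ K x - θ) * z)) : IsSquare (Algebra.norm ℚ z) := by
  have hy : y ≠ 0 := y_ne_zero_of_irreducible hirr hE
  have hN := norm_algebraMap_sub_theta_eq_sq hirr hθ h3 hE
  obtain ⟨r, hr⟩ := hsq
  have hmul := congrArg (Algebra.norm ℚ) hr
  rw [map_mul, map_mul, hN] at hmul
  refine ⟨Algebra.norm ℚ r / y, ?_⟩
  field_simp
  linear_combination hmul

end Norm

/-! ## The real-sign functional -/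

section Real

variable {K : Type*} [Field K] {A B C : ℤ} {θ : K}

/-- **Real points lie to the right of the root carrying the definite cofactor**: if `e ∈ ℝ` is a
root of `F` with `0 < 3e² + 2Ae + 4B − A²` (so `F(t) = (t − e)((t + (e + A)/2)² + (3e²+2Ae+4B−A²)/4)`),
then every rational point `(x, y)`, `y ≠ 0`, has `x > e`. [cite: SilvermanAEC2009, Prop. X.1.4] -/
theorem sub_root_pos {e : ℝ} (he : e ^ 3 + A * e ^ 2 + B * e + C = 0)
    (hq : 0 < 3 * e ^ 2 + 2 * A * e + 4 * B - A ^ 2) {x y : ℚ} (hy : y ≠ 0)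
    (hE : y ^ 2 = x ^ 3 + A * x ^ 2 + B * x + C) : 0 < (x : ℝ) - e := by
  have hfac : (x : ℝ) ^ 3 + A * (x : ℝ) ^ 2 + B * x + C =
      ((x : ℝ) - e) * (((x : ℝ) + (e + A) / 2) ^ 2 + (3 * e ^ 2 + 2 * A * e + 4 * B - A ^ 2) / 4) := by
    linear_combination he
  have hqpos : 0 < ((x : ℝ) + (e + A) / 2) ^ 2 + (3 * e ^ 2 + 2 * A * e + 4 * B - A ^ 2) / 4 := by
    nlinarith [sq_nonneg ((x : ℝ) + (e + A) / 2)]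
  have hF : 0 < (x : ℝ) ^ 3 + A * (x : ℝ) ^ 2 + B * x + C := by
    have hE' : ((y : ℝ)) ^ 2 = (x : ℝ) ^ 3 + A * (x : ℝ) ^ 2 + B * x + C := by exact_mod_cast hE
    rw [← hE']
    have hy' : (y : ℝ) ≠ 0 := by exact_mod_cast hy
    positivity
  rw [hfac] at hF
  exact (mul_pos_iff_of_pos_right hqpos).mp hF

/-- **The real-sign functional**: for a real embedding `ρ` with `e = ρ(θ)` as in `sub_root_pos`,
`ρ(x − θ) > 0` at every rational point. [cite: SilvermanAEC2009, Prop. X.1.4] -/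
theorem sub_rho_theta_pos [CharZero K] (ρ : K →+* ℝ)
    (he : ρ θ ^ 3 + A * ρ θ ^ 2 + B * ρ θ + C = 0)
    (hq : 0 < 3 * ρ θ ^ 2 + 2 * A * ρ θ + 4 * B - A ^ 2) {x y : ℚ} (hy : y ≠ 0)
    (hE : y ^ 2 = x ^ 3 + A * x ^ 2 + B * x + C) : 0 < ρ (algebraMap ℚ K x - θ) := by
  have hx : ρ (algebraMap ℚ K x) = (x : ℝ) := eq_ratCast (ρ.comp (algebraMap ℚ K)) x
  rw [map_sub, hx]
  exact sub_root_pos he hq hy hE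

/-- If `ρ(ξ) > 0` and `ξ·z` is a square of `K`, then `ρ(z) > 0` (`z ≠ 0`). [folklore] -/
theorem rho_pos_of_isSquare_mul (ρ : K →+* ℝ) {ξ z : K} (hξ : 0 < ρ ξ) (hz : z ≠ 0)
    (hsq : IsSquare (ξ * z)) : 0 < ρ z := by
  obtain ⟨r, hr⟩ := hsq
  have hw : ρ ξ * ρ z = ρ r * ρ r := by rw [← map_mul, hr, map_mul]
  have hρz : ρ z ≠ 0 := (map_ne_zero ρ).mpr hz
  rcases lt_trichotomy (ρ z) 0 with hlt | heq | hgt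
  · nlinarith [mul_self_nonneg (ρ r)]
  · exact absurd heq hρz
  · exact hgt

/-- **Positivity of the cofactor from an isolating interval** (the per-curve check): for
`g(e) = 3e² + 2Ae + 4B − A²` and `lo < e < hi`, `g(e) > 0` as soon as either `A² < 3B` (then
`g > 0` on `ℝ`), or `g(lo) ≥ 0`, `g(hi) ≥ 0` and the vertex `−A/3` is not inside `(lo, hi)`.
[folklore] -/
theorem cofactor_pos_of_interval {lo hi : ℚ} {e : ℝ} (hlo : (lo : ℝ) < e) (hhi : e < hi)
    (h : A ^ 2 < 3 * B ∨ (0 ≤ 3 * lo ^ 2 + 2 * A * lo + 4 * B - A ^ 2 ∧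
      0 ≤ 3 * hi ^ 2 + 2 * A * hi + 4 * B - A ^ 2 ∧ (3 * hi + A ≤ 0 ∨ 0 ≤ 3 * lo + A))) :
    0 < 3 * e ^ 2 + 2 * A * e + 4 * B - A ^ 2 := by
  rcases h with h1 | ⟨h2, h3, h4 | h4⟩
  · have h1' : ((A : ℝ)) ^ 2 < 3 * B := by exact_mod_cast h1
    nlinarith [sq_nonneg (e + A / 3)]
  · have h3' : (0 : ℝ) ≤ 3 * (hi : ℝ) ^ 2 + 2 * A * hi + 4 * B - A ^ 2 := by exact_mod_cast h3
    have h4' : 3 * (hi : ℝ) + A ≤ 0 := by exact_mod_cast h4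
    nlinarith [mul_pos (sub_pos.mpr hhi) (by nlinarith : (0 : ℝ) < -(3 * (e + hi) + 2 * A))]
  · have h2' : (0 : ℝ) ≤ 3 * (lo : ℝ) ^ 2 + 2 * A * lo + 4 * B - A ^ 2 := by exact_mod_cast h2
    have h4' : (0 : ℝ) ≤ 3 * (lo : ℝ) + A := by exact_mod_cast h4
    nlinarith [mul_pos (sub_pos.mpr hlo) (by nlinarith : (0 : ℝ) < 3 * (e + lo) + 2 * A)]

/-- A real root of `F` in `(lo, hi)` from a sign change `F(lo) < 0 < F(hi)` (IVT). [folklore] -/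
theorem exists_real_root_of_sign_change {lo hi : ℚ} (hlt : lo < hi)
    (hlo : lo ^ 3 + A * lo ^ 2 + B * lo + C < 0) (hhi : 0 < hi ^ 3 + A * hi ^ 2 + B * hi + C) :
    ∃ e : ℝ, (lo : ℝ) < e ∧ e < hi ∧ e ^ 3 + A * e ^ 2 + B * e + C = 0 := by
  let f : ℝ → ℝ := fun r => r ^ 3 + A * r ^ 2 + B * r + C
  have hf : ContinuousOn f (Set.Icc (lo : ℝ) hi) := by fun_prop
  have hlo' : f lo < 0 := by
    have : ((lo ^ 3 + A * lo ^ 2 + B * lo + C : ℚ) : ℝ) < 0 := by exact_mod_cast hlo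
    simpa [f] using this
  have hhi' : 0 < f hi := by
    have : (0 : ℝ) < ((hi ^ 3 + A * hi ^ 2 + B * hi + C : ℚ) : ℝ) := by exact_mod_cast hhi
    simpa [f] using this
  have hle : (lo : ℝ) ≤ hi := by exact_mod_cast hlt.le
  obtain ⟨r, ⟨hr0, hr1⟩, hr⟩ := intermediate_value_Ioo hle hf ⟨hlo', hhi'⟩
  exact ⟨r, hr0, hr1, hr⟩

/-- **A real embedding `ρ : K → ℝ` with `lo < ρ(θ) < hi`** from a sign change of `F` on
`[lo, hi]` (`θ ↦` the root there, through the power basis `1, θ, θ²`). [folklore] -/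
theorem exists_real_embedding_of_sign_change [NumberField K]
    (hirr : Irreducible (MonicCubic.polyQ A B C)) (hθ : aeval θ (MonicCubic.poly A B C) = 0)
    (h3 : finrank ℚ K = 3) {lo hi : ℚ} (hlt : lo < hi)
    (hlo : lo ^ 3 + A * lo ^ 2 + B * lo + C < 0) (hhi : 0 < hi ^ 3 + A * hi ^ 2 + B * hi + C) :
    ∃ ρ : K →+* ℝ, (lo : ℝ) < ρ θ ∧ ρ θ < hi := by
  obtain ⟨r, hr0, hr1, hr⟩ := exists_real_root_of_sign_change hlt hlo hhi
  set pb := MonicCubic.pb hirr hθ h3 with hpb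
  have hgen : pb.gen = θ := MonicCubic.pb_gen hirr hθ h3
  have hy : aeval r (minpoly ℚ pb.gen) = 0 := by
    rw [hgen, MonicCubic.minpoly_rat_eq hirr hθ, MonicCubic.polyQ_eq]
    simp only [map_add, map_mul, map_pow, aeval_X, aeval_C, eq_ratCast]
    push_cast
    linear_combination hr
  have hθr : (pb.lift r hy).toRingHom θ = r := by
    change pb.lift r hy θ = r
    conv_lhs => rw [← hgen]
    exact PowerBasis.lift_gen pb r hy
  exact ⟨(pb.lift r hy).toRingHom, by rw [hθr]; exact hr0, by rw [hθr]; exact hr1⟩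

/-- Any ring map `ρ : K → ℝ` sends a root of `F` to a real root of `F`. [folklore] -/
theorem rho_theta_root (ρ : K →+* ℝ) (hθ : aeval θ (MonicCubic.poly A B C) = 0) :
    ρ θ ^ 3 + A * ρ θ ^ 2 + B * ρ θ + C = 0 := by
  have h := congrArg ρ (MonicCubic.theta_rel hθ)
  simpa only [map_add, map_mul, map_pow, map_intCast, map_zero] using h

end Real

/-! ## The standard sieve on pairs of sub-products and its soundness -/

section Sieve

/-- **Sign of a product**: a product of non-zero reals is positive iff the number of negative
factors is even. [folklore] -/
theorem prod_pos_iff_even_card_neg {ι : Type*} (s : Finset ι) (a : ι → ℝ) (ha : ∀ i, a i ≠ 0) :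
    0 < ∏ i ∈ s, a i ↔ Even (s.filter (fun i => a i < 0)).card := by
  induction s using Finset.induction_on with
  | empty => simp
  | insert j s hj ih =>
    rw [Finset.prod_insert hj, Finset.filter_insert]
    have hP : ∏ i ∈ s, a i ≠ 0 := Finset.prod_ne_zero_iff.mpr (fun i _ => ha i)
    by_cases hneg : a j < 0
    · rw [if_pos hneg, Finset.card_insert_of_notMem (by simp [hj]), Nat.even_add_one, ← ih,
        mul_pos_iff]
      constructor
      · rintro (⟨h1, -⟩ | ⟨-, h2⟩)
        · exact absurd h1 (not_lt.mpr hneg.le)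
        · exact fun h => absurd h2 (not_lt.mpr h.le)
      · intro h
        exact Or.inr ⟨hneg, lt_of_le_of_ne (not_lt.mp h) hP⟩
    · rw [if_neg hneg, ← ih]
      have hpos : 0 < a j := lt_of_le_of_ne (not_lt.mp hneg) (ha j).symm
      exact mul_pos_iff_of_pos_left hpos

variable {m s : ℕ}

/-- **The standard sieve** on a pair `(T, U)` of sub-products of the unit family and the
prime-generator family: the product of the (integer) norms is a square, and the number of factors
negative at the chosen real place is even. Computable (`decide`). [folklore] -/
def admStd (Nu : Fin m → ℤ) (Ng : Fin s → ℤ) (su : Fin m → Bool) (sg : Fin s → Bool)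
    (T : Finset (Fin m)) (U : Finset (Fin s)) : Bool :=
  decide (IsSquare ((∏ i ∈ T, Nu i) * ∏ j ∈ U, Ng j)) &&
    decide (Even ((T.filter fun i => su i = true).card + (U.filter fun j => sg j = true).card))

/-- The empty pair passes the standard sieve. [folklore] -/
theorem admStd_empty (Nu : Fin m → ℤ) (Ng : Fin s → ℤ) (su : Fin m → Bool) (sg : Fin s → Bool) :
    admStd Nu Ng su sg ∅ ∅ = true := by
  simp [admStd]

variable {K : Type*} [Field K] [NumberField K] {A B C : ℤ} {θ : K}

/-- **Soundness of the standard sieve** (= hypothesis `hadm` of `mordellWeilRank_le_of_coverSet`):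
with certified norms `N(wᵢ) = Nuᵢ`, `N(gⱼ) = Ngⱼ` and sign bits (`true` = negative) at a real place
`ρ` whose root carries the definite cofactor, every pair `(T, U)` realised by a rational point —
`(x − θ)·∏_T w·∏_U g ∈ K²` — passes `admStd`. [cite: Cassels1991LecturesEllipticCurves, §15] -/
theorem admStd_sound (hirr : Irreducible (MonicCubic.polyQ A B C))
    (hθ : aeval θ (MonicCubic.poly A B C) = 0) (h3 : finrank ℚ K = 3) (ρ : K →+* ℝ)
    (hq : 0 < 3 * ρ θ ^ 2 + 2 * A * ρ θ + 4 * B - A ^ 2)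
    {w : Fin m → K} {g : Fin s → K} (hw0 : ∀ i, w i ≠ 0) (hg0 : ∀ j, g j ≠ 0)
    {Nu : Fin m → ℤ} (hNu : ∀ i, Algebra.norm ℚ (w i) = Nu i)
    {Ng : Fin s → ℤ} (hNg : ∀ j, Algebra.norm ℚ (g j) = Ng j)
    {su : Fin m → Bool} (hsu : ∀ i, su i = true ↔ ρ (w i) < 0)
    {sg : Fin s → Bool} (hsg : ∀ j, sg j = true ↔ ρ (g j) < 0)
    (x y : ℚ) (hE : y ^ 2 = x ^ 3 + A * x ^ 2 + B * x + C) (T : Finset (Fin m)) (U : Finset (Fin s))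
    (hsq : IsSquare ((algebraMap ℚ K x - θ) * (∏ i ∈ T, w i) * ∏ j ∈ U, g j)) :
    admStd Nu Ng su sg T U = true := by
  set z := (∏ i ∈ T, w i) * ∏ j ∈ U, g j with hz
  have hsq' : IsSquare ((algebraMap ℚ K x - θ) * z) := by rwa [hz, ← mul_assoc]
  have hz0 : z ≠ 0 := mul_ne_zero (Finset.prod_ne_zero_iff.mpr fun i _ => hw0 i)
    (Finset.prod_ne_zero_iff.mpr fun j _ => hg0 j)
  rw [admStd, Bool.and_eq_true, decide_eq_true_eq, decide_eq_true_eq]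
  constructor
  · -- the norm functional
    have hN := isSquare_norm_of_isSquare_mul hirr hθ h3 hE hsq'
    have hNz : Algebra.norm ℚ z = (((∏ i ∈ T, Nu i) * ∏ j ∈ U, Ng j : ℤ) : ℚ) := by
      rw [hz, map_mul, map_prod, map_prod, Finset.prod_congr rfl (fun i _ => hNu i),
        Finset.prod_congr rfl (fun j _ => hNg j)]
      push_cast
      rfl
    rw [hNz, Rat.isSquare_intCast_iff] at hN
    exact hN
  · -- the real-sign functional
    have hy := y_ne_zero_of_irreducible hirr hE
    have hξ := sub_rho_theta_pos ρ (rho_theta_root ρ hθ) hq hy hE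
    have hρz := rho_pos_of_isSquare_mul ρ hξ hz0 hsq'
    rw [hz, map_mul, map_prod, map_prod] at hρz
    have h1 := prod_pos_iff_even_card_neg T (fun i => ρ (w i)) (fun i => (map_ne_zero ρ).mpr (hw0 i))
    have h2 := prod_pos_iff_even_card_neg U (fun j => ρ (g j)) (fun j => (map_ne_zero ρ).mpr (hg0 j))
    have hfT : T.filter (fun i => su i = true) = T.filter (fun i => ρ (w i) < 0) :=
      Finset.filter_congr (fun i _ => hsu i)
    have hfU : U.filter (fun j => sg j = true) = U.filter (fun j => ρ (g j) < 0) :=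
      Finset.filter_congr (fun j _ => hsg j)
    rw [hfT, hfU, Nat.even_add, ← h1, ← h2]
    rw [mul_pos_iff] at hρz
    rcases hρz with ⟨ha, hb⟩ | ⟨ha, hb⟩
    · exact iff_of_true ha hb
    · exact iff_of_false (not_lt.mpr ha.le) (not_lt.mpr hb.le)

end Sieve

end Summit.BirchSwinnertonDyer.BirchSwinnertonDyer.Rank2Observatory.TwoDescCubic

end
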